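import Summits.AtomisticToContinuum.Crystallization.Theorems.PhononStability.Negative.Mirror
import Literature.MathematicalPhysics.StatisticalMechanics.PeriodicConfigurationSums

/-!
# `PhononStability` (stmt-AtomisticToContinuum-9333), negative side III: the coincident-sublattice witness as a periodic configuration

Geometry for part IV (`Inner` is load-bearing): the conformal cell `A₀ = 0.97·id` is admissible;
its period lattice `A₀Λ` is the tree's Barlow period lattice `L₀` of the alternating (hcp) Hägg
sequence with `a = 0.97`, `h = 0.97√(2/3)`, period `2` (`mem_L₀_iff`), whose nonzero vectors
have norm `≥ 3/4` (`norm_ge_of_mem_L₀'`, from `le_dist_of_mem_barlowStacking`); with sublattice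
translations `t = (0, δe₃)`, `0 < δ ≤ 1/4`, the site set of the crux is the point set of the
periodic configuration `Pδ` with motif `{0, δe₃}` (`sites₀_eq_points`), parametrised bijectively by
labels `Fin 2 × L₀` (`pos`, `param`, `tsum_tsum_points_eq`); far labels sit at distance `≥ ‖l‖/2`
and `≥ 1/2` from the origin (`norm_pos_ge`).  All `[folklore]`.
-/

noncomputable section

namespace Summit.AtomisticToContinuum.Crystallization.Theorems.PhononStabilityNegative

open scoped BigOperators Topology Classical InnerProductSpace
open Filter Set Function
open Literature.MathematicalPhysics.StatisticalMechanics
open Summit.AtomisticToContinuum.Crystallization.Theses.ExcessDecayLiouville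

local notation "E3" => EuclideanSpace ℝ (Fin 3)

/-! ### The conformal cell `A₀ = 0.97·id` and its period lattice -/

/-- The relaxed conformal cell `A₀ = (97/100)·id`. [folklore] -/
def A₀ : E3 →L[ℝ] E3 := (97 / 100 : ℝ) • ContinuousLinearMap.id ℝ E3

/-- `A₀ z = 0.97·z`. [folklore] -/
@[simp] theorem A₀_apply (z : E3) : A₀ z = (97 / 100 : ℝ) • z := rfl

/-- The conformal relaxed cell `A₀ = 0.97·id` is admissible (`R = id`, distance `0`). [folklore] -/
theorem adm₀_A₀ : Adm₀ A₀ := by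
  refine ⟨LinearIsometryEquiv.refl ℝ E3, ?_⟩
  have h : A₀ - (97 / 100 : ℝ) •
      ((LinearIsometryEquiv.refl ℝ E3).toContinuousLinearEquiv : E3 →L[ℝ] E3) = 0 := by
    ext z i
    simp [A₀]
  rw [h, norm_zero]
  norm_num

/-- `0.97 ≠ 0`. [folklore] -/
theorem a97_ne : (97 / 100 : ℝ) ≠ 0 := by norm_num
/-- `0.97·√(2/3) ≠ 0`. [folklore] -/
theorem h97_ne : (97 / 100 : ℝ) * Real.sqrt (2 / 3) ≠ 0 := by positivity

/-- The period lattice `A₀ Λ = ℤ(0.97u) + ℤ(0.97v) + ℤ(0.97·2√(2/3) e₃)`, as the tree's Barlow period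
lattice of the alternating (hcp) Hägg sequence with `a = 0.97`, `h = 0.97√(2/3)`, period `2`. [folklore] -/
def L₀ : Submodule ℤ E3 :=
  barlowPeriodLattice alternatingHagg a97_ne h97_ne (two_ne_zero (α := ℕ))

/-- The alternating Hägg sequence has window sum `0` over one period (`1 + (−1)`). [folklore] -/
theorem haggWindow_alt_two : haggWindow alternatingHagg 0 2 = 0 := by
  rw [haggWindow_alternating]; simp

/-- `A₀` maps the generators of the unit period lattice `Λ` to the Barlow period vectors with `a = 0.97`, `h = 0.97√(2/3)`, `p = 2`. [folklore] -/
theorem A₀_lattice_vec (i j k : ℤ) :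
    A₀ ((i : ℝ) • triangularVec₁ 1 + (j : ℝ) • triangularVec₂ 1 +
      (k : ℝ) • layerNormal (2 * Real.sqrt (2 / 3))) =
    (i : ℝ) • triangularVec₁ (97 / 100) + (j : ℝ) • triangularVec₂ (97 / 100) +
      (k : ℝ) • ((haggWindow alternatingHagg 0 2 : ℝ) • barlowOffset (97 / 100) +
        ((2 : ℕ) : ℝ) • layerNormal ((97 / 100 : ℝ) * Real.sqrt (2 / 3))) := by
  rw [haggWindow_alt_two, A₀_apply]
  ext l
  fin_cases l <;> simp [triangularVec₁, triangularVec₂, barlowOffset, layerNormal] <;> ring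

/-- `L₀ = A₀(Λ)` as sets. [folklore] -/
theorem mem_L₀_iff (g : E3) : g ∈ L₀ ↔ ∃ z ∈ Λ₀, g = A₀ z := by
  constructor
  · intro hg
    obtain ⟨n₀, n₁, n₂, rfl⟩ := exists_eq_of_mem_barlowPeriodLattice _ a97_ne h97_ne two_ne_zero hg
    exact ⟨_, ⟨n₀, n₁, n₂, rfl⟩, (A₀_lattice_vec n₀ n₁ n₂).symm⟩
  · rintro ⟨z, ⟨i, j, k, rfl⟩, rfl⟩
    rw [A₀_lattice_vec]
    exact sum_smul_mem_barlowPeriodLattice _ a97_ne h97_ne two_ne_zero i j k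

/-- Nonzero period vectors are long: `‖g‖ ≥ 0.97·√(2/3)` (they are distinct points of the hcp
stacking with spacings `a = 0.97`, `h = 0.97√(2/3)`). [folklore] -/
theorem norm_ge_of_mem_L₀ {g : E3} (hg : g ∈ L₀) (hg0 : g ≠ 0) :
    (97 / 100 : ℝ) * Real.sqrt (2 / 3) ≤ ‖g‖ := by
  have hpts : g ∈ (hcpPeriodicConfiguration a97_ne h97_ne).points := by
    refine ⟨barlowPos (97 / 100) ((97 / 100 : ℝ) * Real.sqrt (2 / 3)) alternatingHagg 0 0 0,
      ?_, g, hg, ?_⟩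
    · show _ ∈ (Finset.range 2).image _
      exact Finset.mem_image.2 ⟨0, by simp, by simp⟩
    · simp [barlowPos]
  rw [hcpPeriodicConfiguration_points] at hpts
  have h0 : (0 : E3) ∈ hcpStacking (97 / 100) ((97 / 100 : ℝ) * Real.sqrt (2 / 3)) :=
    ⟨0, 0, 0, by simp [barlowPos]⟩
  have := le_dist_of_mem_barlowStacking (97 / 100) ((97 / 100 : ℝ) * Real.sqrt (2 / 3))
    alternatingHagg (by norm_num) (by positivity) h0 hpts hg0.symm
  rw [dist_eq_norm, zero_sub, norm_neg] at this
  refine le_trans ?_ this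
  apply le_min
  · have : Real.sqrt (2 / 3) ≤ 1 := Real.sqrt_le_one.2 (by norm_num)
    nlinarith
  · exact le_rfl

/-! ### The witness configuration: motif `{0, δe₃}` over `L₀` -/

/-- Vertical inner shift `d = δ e₃`. [folklore] -/
def dV (δ : ℝ) : E3 := EuclideanSpace.single 2 δ

/-- `‖δe₃‖ = δ` for `δ ≥ 0`. [folklore] -/
theorem norm_dV {δ : ℝ} (hδ : 0 ≤ δ) : ‖dV δ‖ = δ := by
  rw [dV, PiLp.norm_single, Real.norm_eq_abs, abs_of_nonneg hδ]

/-- `δe₃ ≠ 0` for `δ > 0`. [folklore] -/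
theorem dV_ne_zero {δ : ℝ} (hδ : 0 < δ) : dV δ ≠ 0 := by
  intro h; have := norm_dV hδ.le; rw [h, norm_zero] at this; exact hδ.ne' this.symm

/-- `√(2/3) ≥ 4/5`. [folklore] -/
theorem sqrt_two_thirds_ge : (4 / 5 : ℝ) ≤ Real.sqrt (2 / 3) :=
  Real.le_sqrt_of_sq_le (by norm_num)

/-- Nonzero period vectors have norm `≥ 3/4`. [folklore] -/
theorem norm_ge_of_mem_L₀' {g : E3} (hg : g ∈ L₀) (hg0 : g ≠ 0) : (3 / 4 : ℝ) ≤ ‖g‖ :=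
  le_trans (by nlinarith [sqrt_two_thirds_ge]) (norm_ge_of_mem_L₀ hg hg0)

/-- A short vertical shift is not a period: `δe₃ ∉ L₀` for `0 < δ ≤ 1/4`. [folklore] -/
theorem dV_not_mem_L₀ {δ : ℝ} (h0 : 0 < δ) (h1 : δ ≤ 1 / 4) : dV δ ∉ L₀ := fun h => by
  have := norm_ge_of_mem_L₀' h (dV_ne_zero h0)
  rw [norm_dV h0.le] at this
  linarith

/-- The periodic configuration with period lattice `L₀` and motif `{0, δe₃}` (`0 < δ ≤ 1/4`). [folklore] -/
def Pδ (δ : ℝ) (h0 : 0 < δ) (h1 : δ ≤ 1 / 4) : PeriodicConfiguration 3 where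
  lattice := L₀
  discrete := by unfold L₀ barlowPeriodLattice; infer_instance
  isZLattice := by unfold L₀ barlowPeriodLattice; infer_instance
  motif := {0, dV δ}
  motif_nonempty := by simp
  eq_of_sub_mem := by
    intro x hx y hy hxy
    simp only [Finset.mem_insert, Finset.mem_singleton] at hx hy
    rcases hx with rfl | rfl <;> rcases hy with rfl | rfl
    · rfl
    · exact absurd (by simpa using L₀.neg_mem hxy) (dV_not_mem_L₀ h0 h1)
    · exact absurd (by simpa using hxy) (dV_not_mem_L₀ h0 h1)
    · rfl

/-- Sublattice translations of the witness: `t = (0, δe₃)`. [folklore] -/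
def tV (δ : ℝ) : Fin 2 → E3 := ![0, dV δ]

/-- `t 0 = 0`. [folklore] -/
@[simp] theorem tV_zero (δ : ℝ) : tV δ 0 = 0 := rfl
/-- `t 1 = δe₃`. [folklore] -/
@[simp] theorem tV_one (δ : ℝ) : tV δ 1 = dV δ := rfl

/-- The witness site set is the point set of the periodic configuration `Pδ`. [folklore] -/
theorem sites₀_eq_points (δ : ℝ) (h0 : 0 < δ) (h1 : δ ≤ 1 / 4) :
    Sites₀ (tV δ) A₀ = (Pδ δ h0 h1).points := by
  ext p
  simp only [Sites₀, PeriodicConfiguration.points, Pδ, Set.mem_setOf_eq, Finset.mem_insert,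
    Finset.mem_singleton]
  constructor
  · rintro ⟨m, z, hz, rfl⟩
    refine ⟨tV δ m, ?_, A₀ z, (mem_L₀_iff _).2 ⟨z, hz, rfl⟩, rfl⟩
    fin_cases m <;> simp
  · rintro ⟨y, hy, g, hg, rfl⟩
    obtain ⟨z, hz, rfl⟩ := (mem_L₀_iff g).1 hg
    rcases hy with rfl | rfl
    · exact ⟨0, z, hz, by simp⟩
    · exact ⟨1, z, hz, by simp⟩

/-! ### Parametrising the witness sites by `Fin 2 × L₀` -/

section Param

variable {δ : ℝ}

/-- `‖t m‖ ≤ δ`. [folklore] -/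
theorem norm_tV_le (hδ : 0 ≤ δ) (m : Fin 2) : ‖tV δ m‖ ≤ δ := by
  fin_cases m
  · simp [hδ]
  · simp [norm_dV hδ]

/-- Both translations are motif points of `Pδ`. [folklore] -/
theorem tV_mem_motif (h0 : 0 < δ) (h1 : δ ≤ 1 / 4) (m : Fin 2) : tV δ m ∈ (Pδ δ h0 h1).motif := by
  fin_cases m <;> simp [Pδ]

/-- `t 0 ≠ t 1`. [folklore] -/
theorem tV_injective (h0 : 0 < δ) : Function.Injective (tV δ) := by
  intro m m' h
  fin_cases m <;> fin_cases m'
  · rfl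
  · exact absurd h.symm (by simpa using dV_ne_zero h0)
  · exact absurd h (by simpa using dV_ne_zero h0)
  · rfl

/-- Position of the site with label `(m, l)`: `t_m + l`. [folklore] -/
def pos (δ : ℝ) (a : Fin 2 × L₀) : E3 := tV δ a.1 + (a.2 : E3)

/-- Labels determine sites: `(m, l) ↦ t m + l` is injective (motif points are inequivalent mod `L₀`). [folklore] -/
theorem pos_injective (h0 : 0 < δ) (h1 : δ ≤ 1 / 4) : Function.Injective (pos δ) := by
  rintro ⟨m, l⟩ ⟨m', l'⟩ h
  simp only [pos] at h
  have hsub : tV δ m - tV δ m' = (l' : E3) - l := by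
    rw [sub_eq_sub_iff_add_eq_add, h, add_comm]
  have hmem : tV δ m - tV δ m' ∈ L₀ := by rw [hsub]; exact L₀.sub_mem l'.2 l.2
  have hm : tV δ m = tV δ m' :=
    (Pδ δ h0 h1).eq_of_sub_mem _ (tV_mem_motif h0 h1 m) _ (tV_mem_motif h0 h1 m') hmem
  obtain rfl : m = m' := tV_injective h0 hm
  have hl : (l : E3) = l' := add_left_cancel h
  exact Prod.ext rfl (Subtype.ext hl)

/-- Every label gives a point of `Pδ`. [folklore] -/
theorem pos_mem (h0 : 0 < δ) (h1 : δ ≤ 1 / 4) (a : Fin 2 × L₀) : pos δ a ∈ (Pδ δ h0 h1).points :=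
  ⟨tV δ a.1, tV_mem_motif h0 h1 a.1, a.2, a.2.2, rfl⟩

/-- The parametrisation of the point set of `Pδ` by labels. [folklore] -/
def param (h0 : 0 < δ) (h1 : δ ≤ 1 / 4) (a : Fin 2 × L₀) : (Pδ δ h0 h1).points := ⟨pos δ a, pos_mem h0 h1 a⟩

/-- The parametrisation is injective. [folklore] -/
theorem param_injective (h0 : 0 < δ) (h1 : δ ≤ 1 / 4) : Function.Injective (param h0 h1) := fun _ _ h =>
  pos_injective h0 h1 (congrArg Subtype.val h)

/-- The parametrisation is surjective. [folklore] -/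
theorem range_param (h0 : 0 < δ) (h1 : δ ≤ 1 / 4) : Set.range (param h0 h1) = Set.univ := by
  refine Set.eq_univ_of_forall fun q => ?_
  obtain ⟨y, hy, g, hg, hq⟩ := q.2
  simp only [Pδ, Finset.mem_insert, Finset.mem_singleton] at hy
  rcases hy with rfl | rfl
  · exact ⟨(0, ⟨g, hg⟩), Subtype.ext (by simp [param, pos, hq])⟩
  · exact ⟨(1, ⟨g, hg⟩), Subtype.ext (by simp [param, pos, hq])⟩

/-- Reindexing a double site sum by labels. [folklore] -/
theorem tsum_tsum_points_eq (h0 : 0 < δ) (h1 : δ ≤ 1 / 4) (F : E3 → E3 → ℝ) :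
    ∑' p : (Pδ δ h0 h1).points, ∑' q : (Pδ δ h0 h1).points, F p q =
      ∑' a : Fin 2 × L₀, ∑' b : Fin 2 × L₀, F (pos δ a) (pos δ b) := by
  have hr : ∀ (f : (Pδ δ h0 h1).points → ℝ), Function.support f ⊆ Set.range (param h0 h1) :=
    fun f => by rw [range_param]; exact Set.subset_univ _
  rw [← (param_injective h0 h1).tsum_eq (hr _)]
  refine tsum_congr fun a => ?_
  rw [← (param_injective h0 h1).tsum_eq (hr _)]
  rfl

/-- The label of the origin and of the shifted origin. [folklore] -/
def o₀ : Fin 2 × L₀ := (0, 0)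
/-- The label of the shifted origin `δe₃`. [folklore] -/
def a₁ : Fin 2 × L₀ := (1, 0)

/-- `pos o₀ = 0`. [folklore] -/
@[simp] theorem pos_o₀ : pos δ o₀ = 0 := by simp [pos, o₀]
/-- `pos a₁ = δe₃`. [folklore] -/
@[simp] theorem pos_a₁ : pos δ a₁ = dV δ := by simp [pos, a₁]
/-- `o₀ ≠ a₁`. [folklore] -/
theorem o₀_ne_a₁ : o₀ ≠ a₁ := by simp [o₀, a₁]

/-- Only the label `o₀` sits at the origin. [folklore] -/
theorem pos_eq_zero_iff (h0 : 0 < δ) (h1 : δ ≤ 1 / 4) {a : Fin 2 × L₀} :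
    pos δ a = 0 ↔ a = o₀ := by
  constructor
  · intro h; exact pos_injective h0 h1 (h.trans pos_o₀.symm)
  · rintro rfl; exact pos_o₀

/-- A label other than `o₀, a₁` has a nonzero period component. [folklore] -/
theorem snd_ne_zero_of_ne {a : Fin 2 × L₀} (ha : a ≠ o₀) (ha' : a ≠ a₁) : (a.2 : E3) ≠ 0 := by
  intro h
  have h2 : a.2 = 0 := Subtype.ext h
  obtain ⟨m, l⟩ := a
  simp only at h2
  subst h2
  fin_cases m
  · exact ha rfl
  · exact ha' rfl

/-- Far sites are at distance `≥ ‖l‖/2` and `≥ 1/2` from the origin. [folklore] -/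
theorem norm_pos_ge (h0 : 0 < δ) (h1 : δ ≤ 1 / 4) {a : Fin 2 × L₀} (ha : a ≠ o₀) (ha' : a ≠ a₁) :
    ‖(a.2 : E3)‖ / 2 ≤ ‖pos δ a‖ ∧ (1 / 2 : ℝ) ≤ ‖pos δ a‖ := by
  have hl : (3 / 4 : ℝ) ≤ ‖(a.2 : E3)‖ := norm_ge_of_mem_L₀' a.2.2 (snd_ne_zero_of_ne ha ha')
  have ht : ‖tV δ a.1‖ ≤ 1 / 4 := (norm_tV_le h0.le a.1).trans h1
  have hge : ‖(a.2 : E3)‖ - ‖tV δ a.1‖ ≤ ‖pos δ a‖ := by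
    have := norm_sub_norm_le (a.2 : E3) (-(tV δ a.1))
    rw [norm_neg, sub_neg_eq_add, add_comm] at this
    simpa [pos] using this
  constructor <;> linarith

end Param

end Summit.AtomisticToContinuum.Crystallization.Theorems.PhononStabilityNegative

end
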